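/-
Copyright (c) 2026. All rights reserved.
Released under Apache 2.0 license as described in the file LICENSE.
Authors: abc-iut cell, cone prover seat abc-iut-w6-d030 (wave W6, block C).
-/
import Literature.AnabelianGeometry.AbsoluteAnabelian.LogFrobeniusCompatibility
import HarnessLib

/-!
# [AbsTopIII] Definition 5.4 (vi) (and its nonarchimedean twin (iv)): the functor-level printed clauses, proved

S. Mochizuki, *Topics in absolute anabelian geometry III: global reconstruction algorithms*,
J. Math. Sci. Univ. Tokyo 22 (2015) 939–1156 [MochizukiAbsTopIII2015]; locators `p.N` = pages of the author's
manuscript (`paper:url-5493eb38cbb7`), read on the page: Def 5.4 (iv) p. 127, (v) pp. 127–128, (vi) p. 128.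

PROOF-ONLY companion (no definitions) of the FROZEN interface file `LogFrobeniusCompatibility.lean` (p405623), where
Def 5.4 (vi) — the archimedean case `v ∈ V^arc` of the local categories `𝒩⊞_v → 𝒩_v → Th•[Z]` and of the functors
`λ⊞_{v,ν} : Th•_T[Z] → 𝒩⊞_v` indexed by the vertices `ν` of `Γ⃗^log_v := Γ⃗^log_arc` — is typed as the fields
`Nplus`, `N`, `forget`, `toE`, `lam`, `lamOver`, `lam_spaceLink_eq_postLog` of `LogFrobeniusSetting` at `isArc v = true`
(`LogVertex true = ArchVertex`, `LogEdge true = ArchEdge`, file `LogFrobeniusGraphs.lean`, p404505).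

What print asserts in (vi) beyond the data, and what is proved here over the interface (one statement for every `v`;
`isArc v = true` is the sentence of (vi), `isArc v = false` the verbatim twin sentence of (iv)):
* "λ_{v,ν} : Th•_T[Z] → 𝒩_v — where the latter functor is obtained by composing the former functor with the natural
  functor 𝒩⊞_v → 𝒩_v — that 'lie over' Th•[Z], for each vertex ν of Γ⃗^log_v" (p. 128, last sentence of (vi)):
  `LogFrobeniusSetting.lam_forget_liesOver`;
* the proviso identifying the functors at the space-link and the post-log vertex ("the underlying additive
  topological group of the field k" in both cases, (vi) p. 128 / Cor 5.5 p. 130) descends to `λ_{v,ν}`: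
  `LogFrobeniusSetting.lam_forget_spaceLink_eq_postLog`;
* consequence of Def 5.4 (ii) ("log•_{T,T} lies over Th•") with the above: the twisted functor `λ_{v,ν} ∘ Λ_ν`
  (the domain of `ι_{v,ε}` in Def 5.4 (vii)) lies over `Th•[Z]`: `LogFrobeniusSetting.twist_lam_forget_liesOver`
  (a derived statement, labelled as such);
* the index set of the first construction of (vi), "each vertex ν of Γ⃗^×_v" for `v ∈ V^arc`, in the typing's reading
  `LogVertex.IsCross` (kernel data node `N_AbsTopIII_Def5_4_vi`): these are exactly the two endpoints `k~` (pre-log),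
  `k^×` of the archimedean shell-arrow, i.e. exactly the endpoints of the arrows of `Γ⃗^×_arc := Γ⃗^⋉_arc ∩ Γ⃗^⋊_arc`
  as typed by `ArchEdge.InCore` (coherence of the two frozen encodings): `LogVertex.isCross_arch_iff`,
  `LogVertex.isCross_arch_iff_endpoint_inCore`.

Refereed pre-IUT anabelian geometry; nothing here bears on [IUTchIII] Cor. 3.12; typed ≠ endorsed.
-/

set_option autoImplicit false

universe u

open CategoryTheory

namespace Literature.AnabelianGeometry.AbsoluteAnabelian

namespace LogFrobeniusSetting

variable {Vmod : Type u} {isArc : Vmod → Bool} (S : LogFrobeniusSetting Vmod isArc)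

/-- Def 5.4 (vi) (archimedean `v`, `isArc v = true`) and its twin (iv) (nonarchimedean `v`): "λ_{v,ν} : Th•_T[Z] → 𝒩_v —
where the latter functor is obtained by composing the former functor [λ⊞_{v,ν}] with the natural functor
𝒩⊞_v → 𝒩_v — that 'lie over' Th•[Z], for each vertex ν of Γ⃗^log_v": the composite `λ⊞_{v,ν} ⋙ (𝒩⊞_v → 𝒩_v)`
lies over `Th•[Z]` via `𝒩_v → Th•[Z]`. [cite: MochizukiAbsTopIII2015, Def 5.4 (vi) p. 128] -/
theorem lam_forget_liesOver (v : Vmod) (ν : LogVertex (isArc v)) :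
    Nonempty ((S.lam v ν ⋙ S.forget v) ⋙ S.toE v ≅ S.proj) :=
  ⟨Functor.associator _ _ _ ≪≫ S.lamOver v ν⟩

/-- Def 5.4 (vi)/(iv): the space-link and the post-log vertex are both assigned "the underlying additive topological
group of the field k", so the functors `λ_{v,ν} = λ⊞_{v,ν} ⋙ (𝒩⊞_v → 𝒩_v)` at these two vertices coincide (the
proviso of Cor 5.5 p. 130, recorded for `λ⊞` as the interface field `lam_spaceLink_eq_postLog`).
[cite: MochizukiAbsTopIII2015, Def 5.4 (vi) p. 128] -/
theorem lam_forget_spaceLink_eq_postLog (v : Vmod) :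
    S.lam v (LogVertex.spaceLink (isArc v)) ⋙ S.forget v = S.lam v (LogVertex.postLog (isArc v)) ⋙ S.forget v := by
  rw [S.lam_spaceLink_eq_postLog v]

/-- Derived (Def 5.4 (ii) "log•_{T,T} lies over Th•" + (iv)/(vi) "λ_{v,ν} lie over Th•[Z]"): the twisted functor
`λ_{v,ν} ∘ Λ_ν` — `Λ_ν` the identity at a pre-log vertex, the log-Frobenius functor at the post-log vertex (Def 5.4
(vii)), here `frobeniusTwist S.log b` for the Boolean `b` = "ν is the post-log vertex" — lies over `Th•[Z]`.
[cite: MochizukiAbsTopIII2015, Def 5.4 (vi) p. 128] -/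
theorem twist_lam_forget_liesOver (v : Vmod) (ν : LogVertex (isArc v)) (b : Bool) :
    Nonempty (frobeniusTwist S.log b ⋙ S.lam v ν ⋙ S.forget v ⋙ S.toE v ≅ S.proj) := by
  cases b
  · rw [frobeniusTwist_false]
    exact ⟨Functor.leftUnitor _ ≪≫ S.lamOver v ν⟩
  · rw [frobeniusTwist_true]
    exact ⟨Functor.isoWhiskerLeft S.log (S.lamOver v ν) ≪≫ S.logOver⟩

/-- Def 5.4 (vi)/(iv): in particular `λ⊞_{v,ν} ∘ Λ_ν` itself lies over `Th•[Z]` (same derivation, without the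
forgetful functor `𝒩⊞_v → 𝒩_v` split off). [cite: MochizukiAbsTopIII2015, Def 5.4 (vi) p. 128] -/
theorem twist_lam_liesOver (v : Vmod) (ν : LogVertex (isArc v)) (b : Bool) :
    Nonempty ((frobeniusTwist S.log b ⋙ S.lam v ν) ⋙ S.forget v ⋙ S.toE v ≅ S.proj) :=
  ⟨Functor.associator _ _ _ ≪≫ (S.twist_lam_forget_liesOver v ν b).some⟩

end LogFrobeniusSetting

/-- Def 5.4 (vi): for `v ∈ V^arc` the vertices "ν of Γ⃗^×_v" indexing the first construction of `λ⊞_{v,ν}` — in the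
typing's reading `LogVertex.IsCross` (neither the space-link nor the post-log vertex) — are exactly the pre-log `k~`
and `k^×`, the two endpoints of the archimedean shell-arrow `k~ ↠ k^×` of Def 5.4 (v).
[cite: MochizukiAbsTopIII2015, Def 5.4 (vi) p. 128] -/
theorem LogVertex.isCross_arch_iff (ν : ArchVertex) :
    LogVertex.IsCross (b := true) ν ↔ (ν = .pre ∨ ν = .mult) := by
  cases ν <;> simp [LogVertex.IsCross, LogVertex.isPostLog, LogVertex.isSpaceLink, ArchVertex.IsPostLog]

/-- Def 5.4 (v)/(vi), coherence of the two frozen encodings: a vertex of `Γ⃗^log_arc` is a vertex "of Γ⃗^×_v" in the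
sense used by (vi) (`LogVertex.IsCross`) iff it is an endpoint of an arrow of `Γ⃗^×_arc := Γ⃗^⋉_arc ∩ Γ⃗^⋊_arc`
(`ArchEdge.InCore`, which by `ArchEdge.inCore_iff` is the shell-arrow alone).
[cite: MochizukiAbsTopIII2015, Def 5.4 (vi) p. 128] -/
theorem LogVertex.isCross_arch_iff_endpoint_inCore (ν : ArchVertex) :
    LogVertex.IsCross (b := true) ν ↔ ∃ (a c : ArchVertex) (e : ArchEdge a c), e.InCore ∧ (ν = a ∨ ν = c) := by
  rw [LogVertex.isCross_arch_iff]
  constructor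
  · intro h
    exact ⟨.pre, .mult, .shell, ⟨trivial, trivial⟩, h⟩
  · rintro ⟨a, c, e, he, h⟩
    cases e with
    | postLogId => exact absurd he.2 (fun x => x)
    | shell => exact h
    | multToSpaceLink => exact absurd he.1 (fun x => x)

end Literature.AnabelianGeometry.AbsoluteAnabelian
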